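import Literature.Analysis.FluidPDE.HeatDuhamelEnergy
import Literature.Analysis.FluidPDE.HeatDuhamelSmooth
import HarnessLib

/-!
# The forward Duhamel solution of the inhomogeneous heat equation on `ℝⁿ` (topic `Analysis/PDE`)

First analytic layer of the programme to prove short-time existence for quasilinear strictly
parabolic systems on a closed manifold (hypothesis `hQL` of
`Literature.Geometry.Riemannian.ricciFlow_shortTime_existence_of_quasilinear`,
`RicciDeTurckShortTime.lean`), which is the last input of the named fact
`ricciFlow_shortTime_existence` (Hamilton 1982, Thm. 4.2). The linear engine of that programme is
the constant-coefficient heat equation on the model space with compactly supported smooth data,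
solved by Duhamel's formula. The tree already has the BACKWARD Duhamel integral
`heatDuhamelBack ν Θ` of a space–time test field `Θ` (`FluidPDE/HeatDuhamelBack.lean`: it solves
`∂ₛU + νΔU = -Θ` with `U = 0` after the time support; `HeatDuhamelSmooth.lean`: joint smoothness;
`HeatDuhamelEnergy.lean`: `L²` energy and maximal-regularity estimates, Lemarié-Rieusset 2016,
Prop. 4.3 (B)–(C)). This file records its TIME REVERSAL, the forward solution operator
(Evans, *PDE*, §2.3.1, Thm. 2, Duhamel's principle):

* `heatDuhamelFwd ν Θ t x = heatDuhamelBack ν Θ̌ (-t) x`, `Θ̌(s) = Θ(-s)` — for a space–time test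
  field `Θ : ℝ → E → F` (`E` a finite-dimensional real inner product space, `F` a real Banach
  space) this is `∫_{-∞}^t (e^{ν(t-s)Δ} Θ(s))(x) ds`;
* `IsSpaceTimeTestOn.timeReverse` — `Θ̌` is a space–time test field;
* **the forward heat equation** `∂ₜV = νΔV + Θ` (`hasDerivAt_heatDuhamelFwd_time`,
  `heatDuhamelFwd_heat`), `V(t) = 0` before the time support of `Θ`
  (`heatDuhamelFwd_eq_zero_of_le`), derivatives fall on the data
  (`fderiv_heatDuhamelFwd_apply`, `laplacian_heatDuhamelFwd`), joint smoothness
  (`contDiff_uncurry_heatDuhamelFwd`);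
* **the `L²` estimates forward in time** for `F` a Hilbert space and data vanishing for `t < τ₀`
  (`energy_estimate_heatDuhamelFwd`, `maximalRegularity_heatDuhamelFwd`):
  `sup_{t ∈ [τ₀, T]} ‖V(t)‖₂² ≤ 4(T - τ₀) Q`, `∫_{τ₀}^T Σᵢ ‖∂ᵢV‖₂² ≤ (2(T - τ₀)/ν) Q`,
  `∫_{τ₀}^T Σᵢⱼ ‖∂ⱼ∂ᵢV‖₂² ≤ (n/ν²) Q`, `Q = ∫_{τ₀}^T ‖Θ(s)‖₂² ds` — the short-time gain
  `T - τ₀` for the solution and its gradient, and the `T`-independent maximal regularity of the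
  Hessian, which drive the freezing-of-coefficients Neumann series of the next layers.

Everything is proved; no named fact and no `sorry` is introduced.

## References

* L. C. Evans, *Partial Differential Equations*, 2nd ed., AMS 2010, §2.3.1, Thm. 2 (solution of
  the nonhomogeneous problem by Duhamel's principle). [Evans2010]
* P. G. Lemarié-Rieusset, *The Navier–Stokes problem in the 21st century*, CRC Press 2016,
  Prop. 4.3 (B), (C), pp. 74–75. [LemarieRieusset2016]
-/

open MeasureTheory Filter Topology Set InnerProductSpace Metric Function TopologicalSpace
open scoped Real ENNReal NNReal Laplacian ContDiff

noncomputable section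

namespace Literature.Analysis.PDE

open Literature.Analysis.FluidPDE

variable {E : Type*} [NormedAddCommGroup E] [InnerProductSpace ℝ E] [FiniteDimensional ℝ E]
  [MeasurableSpace E] [BorelSpace E]
variable {F : Type*} [NormedAddCommGroup F] [NormedSpace ℝ F]
variable {ν : ℝ} {Θ : ℝ → E → F}

/-! ### Time reversal of space–time test fields -/

/-- The time reversal `Θ̌(s) = Θ(-s)` of a time-dependent field. [folklore] -/
def timeReverse (Θ : ℝ → E → F) (s : ℝ) : E → F := Θ (-s)

omit [NormedAddCommGroup E] [InnerProductSpace ℝ E] [FiniteDimensional ℝ E] [MeasurableSpace E]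
  [BorelSpace E] [NormedAddCommGroup F] [NormedSpace ℝ F] in
/-- `timeReverse Θ s x = Θ (-s) x`. [folklore] -/
@[simp]
theorem timeReverse_apply (Θ : ℝ → E → F) (s : ℝ) (x : E) : timeReverse Θ s x = Θ (-s) x := rfl

omit [NormedAddCommGroup E] [InnerProductSpace ℝ E] [FiniteDimensional ℝ E] [MeasurableSpace E]
  [BorelSpace E] [NormedAddCommGroup F] [NormedSpace ℝ F] in
/-- Time reversal is an involution. [folklore] -/
@[simp]
theorem timeReverse_timeReverse (Θ : ℝ → E → F) : timeReverse (timeReverse Θ) = Θ := by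
  funext s x
  simp [timeReverse]

omit [MeasurableSpace E] [BorelSpace E] [FiniteDimensional ℝ E] in
/-- **The time reversal of a space–time test field is a space–time test field** (composition
with the linear involution `(s, x) ↦ (-s, x)` of `ℝ × E`). [folklore] -/
theorem isSpaceTimeTestOn_timeReverse (hΘ : IsSpaceTimeTestOn (⊤ : Opens (ℝ × E)) Θ) :
    IsSpaceTimeTestOn (⊤ : Opens (ℝ × E)) (timeReverse Θ) := by
  set R : ℝ × E → ℝ × E := fun p ↦ (-p.1, p.2) with hR
  have hRc : ContDiff ℝ ∞ R := contDiff_fst.neg.prodMk contDiff_snd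
  have hRR : ∀ p, R (R p) = p := fun p ↦ by simp [hR]
  have hcomp : uncurry (timeReverse Θ) = uncurry Θ ∘ R := by
    funext p
    rfl
  set Rh : ℝ × E ≃ₜ ℝ × E := ⟨⟨R, R, hRR, hRR⟩, hRc.continuous, hRc.continuous⟩ with hRh
  refine ⟨?_, ?_, fun _ _ ↦ trivial⟩
  · rw [hcomp]
    exact hΘ.contDiff.comp hRc
  · rw [hcomp]
    exact hΘ.hasCompactSupport.comp_homeomorph Rh

omit [NormedAddCommGroup E] [InnerProductSpace ℝ E] [FiniteDimensional ℝ E] [MeasurableSpace E]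
  [BorelSpace E] in
/-- The time derivative of the time reversal: `∂ₜΘ̌(s) = -(∂ₜΘ)(-s)`. [folklore] -/
theorem timeDeriv_timeReverse (Θ : ℝ → E → F) (s : ℝ) (x : E) :
    timeDeriv (timeReverse Θ) s x = -timeDeriv Θ (-s) x := by
  simp only [timeDeriv, timeReverse]
  have h := deriv_comp_neg (f := fun r ↦ Θ r x) s
  exact h

omit [NormedAddCommGroup E] [InnerProductSpace ℝ E] [FiniteDimensional ℝ E] [MeasurableSpace E]
  [BorelSpace E] [NormedSpace ℝ F] in
/-- Time support of the time reversal. [folklore] -/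
theorem timeReverse_eq_zero_of_notMem {a b : ℝ} (hab : ∀ t, t ∉ Icc a b → Θ t = 0) (t : ℝ)
    (ht : t ∉ Icc (-b) (-a)) : timeReverse Θ t = 0 := by
  refine hab (-t) fun h ↦ ht ⟨?_, ?_⟩ <;> linarith [h.1, h.2]

/-! ### The forward Duhamel integral -/

/-- **The forward Duhamel integral** `𝒱[Θ](t)(x) = ∫_{-∞}^t (e^{ν(t-s)Δ} Θ(s))(x) ds` of a
space–time field, defined as the time reversal of the tree's backward Duhamel integral:
`𝒱[Θ](t) = 𝒰[Θ̌](-t)` (Evans, *PDE*, §2.3.1, (13): solution of the nonhomogeneous heat equation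
by Duhamel's principle). [cite: Evans2010, §2.3.1, Thm. 2] -/
def heatDuhamelFwd (ν : ℝ) (Θ : ℝ → E → F) (t : ℝ) (x : E) : F :=
  heatDuhamelBack ν (timeReverse Θ) (-t) x

/-- Unfolding `heatDuhamelFwd`. [folklore] -/
theorem heatDuhamelFwd_apply (ν : ℝ) (Θ : ℝ → E → F) (t : ℝ) (x : E) :
    heatDuhamelFwd ν Θ t x = heatDuhamelBack ν (timeReverse Θ) (-t) x := rfl

variable [CompleteSpace F]

omit [CompleteSpace F] in
/-- **Before the data start the forward Duhamel integral vanishes**: if `Θ(s) = 0` for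
`s ∉ [a, b]` then `𝒱[Θ](t) = 0` for `t ≤ a` (zero initial value). [cite: Evans2010, §2.3.1, Thm. 2] -/
theorem heatDuhamelFwd_eq_zero_of_le (hΘ : IsSpaceTimeTestOn (⊤ : Opens (ℝ × E)) Θ) (hν : 0 < ν)
    {a b : ℝ} (hab : ∀ t, t ∉ Icc a b → Θ t = 0) {t : ℝ} (ht : t ≤ a) (x : E) :
    heatDuhamelFwd ν Θ t x = 0 :=
  (isSpaceTimeTestOn_timeReverse hΘ).heatDuhamelBack_eq_zero_of_le hν (timeReverse_eq_zero_of_notMem hab)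
    (by linarith) x

/-- **Spatial derivatives fall on the data**: `∂ᵥ(𝒱[Θ](t))(x) = 𝒱[∂ᵥΘ](t)(x)`. [folklore] -/
theorem fderiv_heatDuhamelFwd_apply (hΘ : IsSpaceTimeTestOn (⊤ : Opens (ℝ × E)) Θ) (hν : 0 < ν)
    (t : ℝ) (x v : E) :
    fderiv ℝ (heatDuhamelFwd ν Θ t) x v =
      heatDuhamelFwd ν (fun s y ↦ fderiv ℝ (Θ s) y v) t x := by
  have h := (isSpaceTimeTestOn_timeReverse hΘ).fderiv_heatDuhamelBack_apply hν (-t) x v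
  exact h

/-- **The Laplacian falls on the data**: `Δ(𝒱[Θ](t))(x) = 𝒱[ΔΘ](t)(x)`. [folklore] -/
theorem laplacian_heatDuhamelFwd (hΘ : IsSpaceTimeTestOn (⊤ : Opens (ℝ × E)) Θ) (hν : 0 < ν)
    (t : ℝ) (x : E) :
    (Δ (heatDuhamelFwd ν Θ t)) x = heatDuhamelFwd ν (fun s ↦ Δ (Θ s)) t x := by
  have h := (isSpaceTimeTestOn_timeReverse hΘ).laplacian_heatDuhamelBack hν (-t) x
  exact h

omit [CompleteSpace F] in
/-- Homogeneity of the backward Duhamel integral: `𝒰[a • Θ] = a • 𝒰[Θ]` (no integrability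
needed: the Bochner integrals scale). [folklore] -/
theorem heatDuhamelBack_const_smul (a ν : ℝ) (Θ : ℝ → E → F) (s : ℝ) (x : E) :
    heatDuhamelBack ν (fun t y ↦ a • Θ t y) s x = a • heatDuhamelBack ν Θ s x := by
  rw [heatDuhamelBack_apply, heatDuhamelBack_apply, ← integral_smul]
  refine setIntegral_congr_fun measurableSet_Ioi fun σ _ ↦ ?_
  simp_rw [UnboundedOperators.heatExtension_apply, smul_comm (UnboundedOperators.heatKernel _ _) a,
    integral_smul]

omit [CompleteSpace F] in
/-- `𝒰[-Θ] = -𝒰[Θ]`. [folklore] -/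
theorem heatDuhamelBack_neg (ν : ℝ) (Θ : ℝ → E → F) (s : ℝ) (x : E) :
    heatDuhamelBack ν (fun t y ↦ -Θ t y) s x = -heatDuhamelBack ν Θ s x := by
  have h := heatDuhamelBack_const_smul (-1) ν Θ s x
  simp only [neg_smul, one_smul] at h
  exact h

omit [CompleteSpace F] in
/-- **The time derivative falls on the data**: `∂ₜ 𝒱[Θ](t)(x) = 𝒱[∂ₜΘ](t)(x)`.
[cite: Evans2010, §2.3.1, Thm. 2] -/
theorem hasDerivAt_heatDuhamelFwd_time (hΘ : IsSpaceTimeTestOn (⊤ : Opens (ℝ × E)) Θ) (hν : 0 < ν)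
    (t : ℝ) (x : E) :
    HasDerivAt (fun t' ↦ heatDuhamelFwd ν Θ t' x) (heatDuhamelFwd ν (timeDeriv Θ) t x) t := by
  have h := (isSpaceTimeTestOn_timeReverse hΘ).hasDerivAt_heatDuhamelBack_time hν (-t) x
  -- chain rule along `t' ↦ -t'`
  have hc := h.scomp t (hasDerivAt_neg t)
  have hfun : timeDeriv (timeReverse Θ) = fun s y ↦ -(timeReverse (timeDeriv Θ)) s y := by
    funext s y
    rw [timeDeriv_timeReverse, timeReverse_apply]
  rw [hfun, heatDuhamelBack_neg] at hc
  simp only [smul_neg, neg_smul, one_smul, neg_neg] at hc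
  exact hc

/-- **The forward heat equation** `∂ₜV = νΔV + Θ` for `V = 𝒱[Θ]`, `Θ` a space–time test field
(time reversal of `heatDuhamelBack_backward_heat`: `∂ₛU + νΔU = -Θ̌`).
[cite: Evans2010, §2.3.1, Thm. 2] -/
theorem heatDuhamelFwd_heat (hΘ : IsSpaceTimeTestOn (⊤ : Opens (ℝ × E)) Θ) (hν : 0 < ν) (t : ℝ)
    (x : E) :
    HasDerivAt (fun t' ↦ heatDuhamelFwd ν Θ t' x)
      (ν • (Δ (heatDuhamelFwd ν Θ t)) x + Θ t x) t := by
  have hder := hasDerivAt_heatDuhamelFwd_time hΘ hν t x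
  have hback := (isSpaceTimeTestOn_timeReverse hΘ).heatDuhamelBack_backward_heat hν (-t) x
  have hfun : timeDeriv (timeReverse Θ) = fun s y ↦ -(timeReverse (timeDeriv Θ)) s y := by
    funext s y
    rw [timeDeriv_timeReverse, timeReverse_apply]
  rw [hfun, heatDuhamelBack_neg, timeReverse_apply, neg_neg] at hback
  -- `hback : -𝒱[∂ₜΘ](t) + ν 𝒰[ΔΘ̌](-t) = -Θ t x`
  have hlap : heatDuhamelBack ν (fun s ↦ Δ (timeReverse Θ s)) (-t) x =
      (Δ (heatDuhamelFwd ν Θ t)) x := by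
    rw [laplacian_heatDuhamelFwd hΘ hν t x]
    rfl
  have hval : heatDuhamelFwd ν (timeDeriv Θ) t x = ν • (Δ (heatDuhamelFwd ν Θ t)) x + Θ t x := by
    rw [← hlap]
    have h2 : heatDuhamelBack ν (timeReverse (timeDeriv Θ)) (-t) x =
        heatDuhamelFwd ν (timeDeriv Θ) t x := rfl
    rw [h2] at hback
    have h3 : ν • heatDuhamelBack ν (fun s ↦ Δ (timeReverse Θ s)) (-t) x + Θ t x =
        heatDuhamelFwd ν (timeDeriv Θ) t x := by
      have h4 := hback
      -- rearrange
      rw [neg_add_eq_sub, sub_eq_iff_eq_add] at h4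
      rw [h4]
      abel
    exact h3.symm
  rw [← hval]
  exact hder

/-- **Joint smoothness** of `(t, x) ↦ 𝒱[Θ](t)(x)` (from `contDiff_uncurry_heatDuhamelBack`).
[folklore] -/
theorem contDiff_uncurry_heatDuhamelFwd (hΘ : IsSpaceTimeTestOn (⊤ : Opens (ℝ × E)) Θ)
    (hν : 0 < ν) : ContDiff ℝ ∞ (uncurry (heatDuhamelFwd ν Θ)) := by
  have h := (isSpaceTimeTestOn_timeReverse hΘ).contDiff_uncurry_heatDuhamelBack_infty hν
  have hR : ContDiff ℝ ∞ (fun p : ℝ × E ↦ ((-p.1, p.2) : ℝ × E)) :=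
    contDiff_fst.neg.prodMk contDiff_snd
  exact h.comp hR

/-- `𝒱[Θ](t)` is smooth in `x`. [folklore] -/
theorem contDiff_heatDuhamelFwd (hΘ : IsSpaceTimeTestOn (⊤ : Opens (ℝ × E)) Θ) (hν : 0 < ν)
    (t : ℝ) : ContDiff ℝ ∞ (heatDuhamelFwd ν Θ t) :=
  (contDiff_uncurry_heatDuhamelFwd hΘ hν).comp (contDiff_prodMk_right t)

omit [NormedSpace ℝ F] [CompleteSpace F] in
/-- Change of variables `s ↦ -s` in the data integral. [folklore] -/
theorem intervalIntegral_timeReverse_sq_norm (Θ : ℝ → E → F) (τ₀ T : ℝ) :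
    ∫ s in (-T)..(-τ₀), ∫ x, ‖timeReverse Θ s x‖ ^ 2 = ∫ s in τ₀..T, ∫ x, ‖Θ s x‖ ^ 2 := by
  have h := intervalIntegral.integral_comp_neg (a := -T) (b := -τ₀)
    (f := fun s ↦ ∫ x, ‖Θ s x‖ ^ 2)
  simpa only [timeReverse_apply, neg_neg] using h

/-! ### The `L²` estimates forward in time -/

section Energy

variable {F : Type*} [NormedAddCommGroup F] [InnerProductSpace ℝ F] [CompleteSpace F]
  {Θ : ℝ → E → F}

/-- **Energy estimate for the forward Duhamel integral** (Lemarié-Rieusset 2016, Prop. 4.3 (B),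
forward in time): for a space–time test field `Θ` vanishing for `s < τ₀` (time support in
`[τ₀, b]`) and `τ₀ ≤ T`, writing `Q = ∫_{τ₀}^T ‖Θ(s)‖₂² ds`,
`sup_{t ∈ [τ₀, T]} ‖𝒱[Θ](t)‖₂² ≤ 4 (T - τ₀) Q` and `∫_{τ₀}^T Σᵢ ‖∂ᵢ𝒱[Θ]‖₂² ≤ (2(T - τ₀)/ν) Q` —
the short-time gains. [cite: LemarieRieusset2016, Prop. 4.3 (B)] -/
theorem energy_estimate_heatDuhamelFwd (hΘ : IsSpaceTimeTestOn (⊤ : Opens (ℝ × E)) Θ) (hν : 0 < ν)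
    {τ₀ b : ℝ} (hab : ∀ t, t ∉ Icc τ₀ b → Θ t = 0) {T : ℝ} (hτ₀T : τ₀ ≤ T) :
    (∀ t ∈ Icc τ₀ T, ∫ x, ‖heatDuhamelFwd ν Θ t x‖ ^ 2 ≤
        4 * (T - τ₀) * ∫ s in τ₀..T, ∫ x, ‖Θ s x‖ ^ 2) ∧
      ∫ t in τ₀..T, ∑ i, ∫ x, ‖fderiv ℝ (heatDuhamelFwd ν Θ t) x (stdOrthonormalBasis ℝ E i)‖ ^ 2 ≤
        2 * (T - τ₀) / ν * ∫ s in τ₀..T, ∫ x, ‖Θ s x‖ ^ 2 := by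
  have hrev := isSpaceTimeTestOn_timeReverse hΘ
  have habr : ∀ t, t ∉ Icc (-b) (-τ₀) → timeReverse Θ t = 0 := timeReverse_eq_zero_of_notMem hab
  obtain ⟨h1, h2⟩ := hrev.energy_estimate_zero hν habr (τ₀ := -T) (T := -τ₀) (by linarith) le_rfl
  rw [intervalIntegral_timeReverse_sq_norm] at h1 h2
  refine ⟨fun t ht ↦ ?_, ?_⟩
  · have h := h1 (-t) ⟨by linarith [ht.2], by linarith [ht.1]⟩
    have hTT : -τ₀ - -T = T - τ₀ := by ring
    rw [hTT] at h
    exact h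
  · have hTT : -τ₀ - -T = T - τ₀ := by ring
    rw [hTT] at h2
    have hcv := intervalIntegral.integral_comp_neg (a := τ₀) (b := T)
      (f := fun t ↦ ∑ i, ∫ x, ‖fderiv ℝ (heatDuhamelBack ν (timeReverse Θ) t) x
        (stdOrthonormalBasis ℝ E i)‖ ^ 2)
    rw [← hcv] at h2
    exact h2

/-- **Maximal regularity of the forward Duhamel integral** (Lemarié-Rieusset 2016,
Prop. 4.3 (C), forward in time): for a space–time test field `Θ` vanishing for `s < τ₀` and
`τ₀ ≤ T`, `∫_{τ₀}^T Σᵢⱼ ‖∂ⱼ∂ᵢ𝒱[Θ]‖₂² ≤ (n/ν²) ∫_{τ₀}^T ‖Θ(s)‖₂² ds` — the `T`-independent bound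
on the Hessian. [cite: LemarieRieusset2016, Prop. 4.3 (C)] -/
theorem maximalRegularity_heatDuhamelFwd (hΘ : IsSpaceTimeTestOn (⊤ : Opens (ℝ × E)) Θ)
    (hν : 0 < ν) {τ₀ b : ℝ} (hab : ∀ t, t ∉ Icc τ₀ b → Θ t = 0) {T : ℝ} (hτ₀T : τ₀ ≤ T) :
    ∫ t in τ₀..T, ∑ i, ∑ j, ∫ x,
        ‖fderiv ℝ (fun y ↦ fderiv ℝ (heatDuhamelFwd ν Θ t) y (stdOrthonormalBasis ℝ E i)) x
          (stdOrthonormalBasis ℝ E j)‖ ^ 2 ≤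
      (Module.finrank ℝ E : ℝ) / ν ^ 2 * ∫ s in τ₀..T, ∫ x, ‖Θ s x‖ ^ 2 := by
  have hrev := isSpaceTimeTestOn_timeReverse hΘ
  have habr : ∀ t, t ∉ Icc (-b) (-τ₀) → timeReverse Θ t = 0 := timeReverse_eq_zero_of_notMem hab
  have h := hrev.energy_estimate_one hν habr (τ₀ := -T) (T := -τ₀) (by linarith) le_rfl
  rw [intervalIntegral_timeReverse_sq_norm] at h
  have hcv := intervalIntegral.integral_comp_neg (a := τ₀) (b := T)
    (f := fun t ↦ ∑ i, ∑ j, ∫ x, ‖fderiv ℝ (fun y ↦ fderiv ℝ (heatDuhamelBack ν (timeReverse Θ) t) y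
      (stdOrthonormalBasis ℝ E i)) x (stdOrthonormalBasis ℝ E j)‖ ^ 2)
  rw [← hcv] at h
  exact h

end Energy

end Literature.Analysis.PDE

end
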